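import Literature.MathematicalPhysics.QuantumFieldTheory.Balaban1983to89.B3Sect3DegreeCensus

/-!
# `Balaban1983to89.B3Sect3DivergentClasses` — T. Bałaban, *(Higgs)₂,₃ quantum fields in a finite volume. III. Renormalization*,
Commun. Math. Phys. **88** (1983) 411–445 [Balaban1983Higgs3]: the *"remaining possibilities for nonvacuum graphs"* p. 435, the
degrees of the SELF-ENERGY GRAPHS FOR VECTOR FIELDS — (3.25) *"(D = −d + 2)"* p. 439 and *"The other primitively divergent graphs …
have degree 0"* p. 442 — and of the graphs with two scalar legs and one vector leg — *"(3.33) … and the degree is 0"* p. 443 —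
DECIDED on the concrete family of graphs `B3Cor23Concrete.Graph`

statement-level skeleton of published theorems with citation tags; proofs where landed; nothing here is a claim about the Yang–Mills mass gap

PDF held: `paper:balaban1983-higgs-2-3-quantum-fields-finite-volume` (journal page = PDF page + 410); renders read as images:
`…/b2b-balaban-ref1/pages/1983-cmp88-higgs23-III/1983-cmp88-higgs23-III-p025, p029, p032, p033-x2.png` (pp. 435, 439, 442, 443).
CITATION HEADER (lean-in-tree rule).  lit-balaban TYPED SKELETON (HOME `run/shared/lean/pub/lit-balaban/`), Phase 2, seat p18 (gen 3),
unit `lit-balaban-p18`; SKELETON rows **B3.Eq3.25-3.32** (the pictures (3.25), their tag *"(D = −d + 2)"*, the p. 442 sentence),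
**B3.Eq3.33-3.38** (*"and the degree is 0"*, p. 443), **B3.Eq2.18-2.22** (the vertex content of the pictures (2.18)–(2.21), cf.
HOME/GAPS.md G-B3-03) and the p. 435 classification sentence (lead-in of **B3.Eq3.6-3.9**), fold owner r15.  Degree formula: `…B3Sect3DegreeCensus`; the pictures (3.25) as graphs of the model: `…B3Sect3LowestOrderGraphs`
(`g325a/b/c/d`); scalar self-energy: `…B3Sect3ScalarSEDegrees`.

WHAT THIS MODULE PROVES (d = 3, sorry-free, theorems only; «vector legs» = uncontracted A′-legs and Ã-legs together, gen-2
convention).  (1) `deg_eq_zero_of_twoScalar_oneVector` (p. 443): D(G) ≤ 0 with two external φ′-legs and one external vector leg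
forces D(G) = 0; `threeLeg_structure` (pp. 429–430): such a graph has no vertex (1.7), no external differentiation, and either
exactly one A′-line, no vertex (1.6) and 2 ≤ #vertices ≤ 3, or no A′-line, one vertex (1.6) and 2 vertices — the vertex content of
(2.18)–(2.21) and of the two extra graphs X1, X2 of G-B3-03.  (2) `deg_vectorSE` (p. 439/442): D(G) ≤ 0 with two external vector legs and no external φ′-leg forces D(G) ∈
{0, −1}, and D(G) = −1 iff no A′-line, no vertex (1.6)/(1.7), no external differentiation; `lowestOrder_vectorSE` (n̄ ≥ 2): these are,
at the level of vertices and incidences, the pictures (3.25) — two vertices (1.8) with n + n′ = 1 and both φ′-legs internal, or one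
vertex (1.8)/(1.10) with n + n′ = 2 and its φ′-legs joined (the model does not impose connectedness: with two vertices the two
φ′-lines may also close into two tadpoles).  (3) `deg_pos_of_numExtScalarLegs_eq_four`, `extLegs_of_deg_nonpos`,
`remaining_possibilities` (p. 435): a divergent graph has no external φ′-leg and ≤ 3 vector legs, or two φ′-legs and ≤ 2 vector
legs; excluding the vacuum graphs, the four-leg graph (2.4) (p. 429) and the graphs with an odd number of vector legs only (they
vanish, p. 434) leaves exactly the three printed possibilities.  NOT here: the analytic treatment (3.26)–(3.38) (r15
`B3Sect3VectorSelfEnergy`, `B3Sect3TriangleGraphs`), the Ward–Takahashi classes, connectedness / 1PI.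
-/

namespace Literature.MathematicalPhysics.QuantumFieldTheory.Balaban1983to89.B3Sect3DivergentClasses

open Finset B3Prop1 B3Sect2Statements B3VertexBridge B3Cor23Concrete B3DivergentGraphs B3ScalarLegParity B3OddVectorLoops
  B3Sect3DegreeCensus

variable {nbar : ℕ} (G : Graph nbar)

/-! ## p. 443: two scalar legs and one vector leg -/

/-- **p. 443** [PDF 33], verbatim (the graphs with two external scalar legs and one external vector leg, (2.18)–(2.21)):
*"Generally an expression corresponding to these graphs has the form … (3.33) and the degree is 0."* — PROVED on the model,
d = 3: a graph with D(G) ≤ 0, two external φ′-legs and one external vector leg (A′ or Ã) has D(G) = 0 exactly (no such graph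
has negative degree). [cite: Balaban1983Higgs3, (3.33) p.443] -/
theorem deg_eq_zero_of_twoScalar_oneVector (hD : G.deg 3 ≤ 0) (hs : numExtScalarLegs G = 2)
    (hv : numExtVectorLegs G + numTildeLegs G = 1) : G.deg 3 = 0 := by
  have hG := not_hasVertex1315_of_deg_nonpos G hD
  have hb := two_deg_three_eq_budget G hG
  have hb6 := budget_le_six G hD
  have hV := nV_le G hG
  have h1 := one_le_nV G
  have hsc := two_nV_add_eq G hG
  have heo := eOrder_eq G
  obtain ⟨k, hk⟩ := even_numIntVectorLegs G
  suffices h : budget G = 6 by rw [h] at hb; push_cast at hb; linarith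
  by_contra hne
  unfold budget at hb6 hne
  have hnV : G.nV = 1 := by omega
  obtain ⟨⟨i₀, -⟩, -⟩ := G.exists_line
  have hint := two_le_int_of_subsingleton G (fun i j => Fin.ext (by omega)) i₀
  have hS := sum_eq_of_nV_eq_one G hnV i₀ G.intScalar
  have hIV : numIntVectorLegs G = G.intVector i₀ := sum_eq_of_nV_eq_one G hnV i₀ G.intVector
  omega

/-- **pp. 429–430** [PDF 19–20], the pictures (2.18)–(2.21) (two external scalar legs and one external vector leg; p. 430: *"In fact
the only other divergent graphs of this class are: (2.21)"*) — their VERTEX CONTENT decided on the model, d = 3: a graph with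
D(G) ≤ 0, two external φ′-legs and one external vector leg (A′ or Ã) has no vertex (1.7), no differentiation on an external leg,
and EITHER exactly one A′-line, no vertex (1.6) and two or three vertices (all of the form (1.8)/(1.10): the pictures (2.18)–(2.20),
(2.21a)–(2.21e), and X2 of HOME/GAPS.md G-B3-03) OR no A′-line, exactly one vertex (1.6) and exactly two vertices ((2.21f) and X1
of G-B3-03).  The enumeration of the line placements themselves stays the mechanical check of G-B3-03.
[cite: Balaban1983Higgs3, (2.21) p.430] -/
theorem threeLeg_structure (hD : G.deg 3 ≤ 0) (hs : numExtScalarLegs G = 2) (hv : numExtVectorLegs G + numTildeLegs G = 1) :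
    numV17 G = 0 ∧ numExtDiffs G = 0 ∧
      ((numIntVectorLegs G = 2 ∧ numV16 G = 0 ∧ 2 ≤ G.nV ∧ G.nV ≤ 3) ∨
       (numIntVectorLegs G = 0 ∧ numV16 G = 1 ∧ G.nV = 2)) := by
  have hG := not_hasVertex1315_of_deg_nonpos G hD
  have h0 := deg_eq_zero_of_twoScalar_oneVector G hD hs hv
  have hb : budget G = 6 := by
    have := two_deg_three_eq_budget G hG
    rw [h0] at this
    have : (budget G : ℚ) = 6 := by linarith
    exact_mod_cast this
  have hV := nV_le G hG
  have h1 := one_le_nV G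
  have hsc := two_nV_add_eq G hG
  have heo := eOrder_eq G
  obtain ⟨k, hk⟩ := even_numIntVectorLegs G
  unfold budget at hb
  have h17 : numV17 G = 0 := by omega
  -- no external differentiation: otherwise a single vertex without any line
  have hX : numExtDiffs G = 0 := by
    by_contra hX
    have hnV : G.nV = 1 := by omega
    obtain ⟨⟨i₀, -⟩, -⟩ := G.exists_line
    have hint := two_le_int_of_subsingleton G (fun i j => Fin.ext (by omega)) i₀
    have hS := sum_eq_of_nV_eq_one G hnV i₀ G.intScalar
    have hIV : numIntVectorLegs G = G.intVector i₀ := sum_eq_of_nV_eq_one G hnV i₀ G.intVector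
    omega
  refine ⟨h17, hX, ?_⟩
  by_cases h16 : numV16 G = 1
  · right
    have hiv : numIntVectorLegs G = 0 := by omega
    refine ⟨hiv, h16, ?_⟩
    -- two vertices: (1.6) alone carries no vector leg
    rcases Nat.lt_or_ge G.nV 2 with hlt | hge
    · exfalso
      have hnV : G.nV = 1 := by omega
      obtain ⟨⟨i₀, -⟩, -⟩ := G.exists_line
      have hkind : G.kind i₀ = .v16 := by
        have := sum_eq_of_nV_eq_one G hnV i₀ fun j => if G.kind j = .v16 then 1 else 0
        rw [← numV16_eq_sum, h16] at this
        by_contra hc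
        simp [hc] at this
      have hdv := sum_eq_of_nV_eq_one G hnV i₀ fun j => (G.kind j).dv
      rw [← eOrder, hkind, show VertexKind.v16.dv = 0 from rfl] at hdv
      omega
    · omega
  · left
    have h16' : numV16 G = 0 := by omega
    have hiv : numIntVectorLegs G = 2 := by omega
    refine ⟨hiv, h16', ?_, by omega⟩
    -- one vertex is impossible: it would be (1.8) with n + n′ = 3 and no internal φ′-leg, or (1.10) with n + n′ = 3 (odd)
    by_contra hlt
    have hnV : G.nV = 1 := by omega
    obtain ⟨⟨i₀, -⟩, -⟩ := G.exists_line
    have hS := sum_eq_of_nV_eq_one G hnV i₀ G.intScalar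
    have hXi := sum_eq_of_nV_eq_one G hnV i₀ fun j => (G.kind j).diffCount - G.intDiffs j
    rw [← numExtDiffs_eq, hX] at hXi
    have hdi := B3Cor23ConcreteTwoDim.intDiffs_le_intScalar G i₀
    have hdv := sum_eq_of_nV_eq_one G hnV i₀ fun j => (G.kind j).dv
    rw [← eOrder] at hdv
    have hadm := G.adm i₀
    have h1315 := isOfForm1315_eq_false G hG i₀
    have hn16 := kind_ne_v16 G h16' i₀
    have hn17 := kind_ne_v17 G h17 i₀
    have htl := extVectorLegs_le G i₀
    generalize G.kind i₀ = v at hadm h1315 hn16 hn17 hdv hXi htl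
    cases v with
    | v16 => exact hn16 rfl
    | v17 => exact hn17 rfl
    | v18 n n' => simp [VertexKind.diffCount] at hXi; omega
    | v19 n nb => simp [VertexKind.diffCount] at hXi; omega
    | v110 n n' =>
      obtain ⟨⟨m, hm⟩, -, -, -⟩ := hadm
      simp [VertexKind.dv] at hdv
      omega
    | v111 n nb =>
      obtain ⟨hnb, hn⟩ := hadm
      simp [VertexKind.dv] at hdv
      simp [VertexKind.extVectorLegs] at htl
      omega
    | v113 => simp [VertexKind.isOfForm1315] at h1315
    | v114 n n' => simp [VertexKind.isOfForm1315] at h1315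
    | v115 n nb => simp [VertexKind.isOfForm1315] at h1315

/-! ## pp. 439–442: self-energy graphs for vector fields -/

/-- **(3.25)** p. 439 [PDF 29] *"(D = −d + 2)"* and **p. 442** [PDF 32], verbatim: *"The other primitively divergent graphs are
considered in a simpler way, because they have degree 0."* (self-energy graphs for vector fields) — PROVED on the model, d = 3: a
graph with D(G) ≤ 0 and exactly two external vector legs (A′-legs and Ã-legs together) and no external φ′-leg has D(G) = 0 or
D(G) = −1 = −d + 2, and D(G) = −1 iff it has no A′-line, no vertex (1.6)/(1.7) and no differentiation on an external leg
(`lowestOrder_vectorSE` identifies these: the pictures (3.25)). [cite: Balaban1983Higgs3, (3.25) p.439] -/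
theorem deg_vectorSE (hD : G.deg 3 ≤ 0) (hs : numExtScalarLegs G = 0) (hv : numExtVectorLegs G + numTildeLegs G = 2) :
    (G.deg 3 = 0 ∨ G.deg 3 = -1) ∧
      (G.deg 3 = -1 ↔ numIntVectorLegs G = 0 ∧ numV16 G = 0 ∧ numV17 G = 0 ∧ numExtDiffs G = 0) := by
  have hG := not_hasVertex1315_of_deg_nonpos G hD
  have hb := two_deg_three_eq_budget G hG
  have hb6 := budget_le_six G hD
  obtain ⟨k, hk⟩ := even_numIntVectorLegs G
  have hcases : budget G = 4 ∨ budget G = 6 := by unfold budget at hb6 ⊢; omega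
  have hiff : budget G = 4 ↔ (numIntVectorLegs G = 0 ∧ numV16 G = 0 ∧ numV17 G = 0 ∧ numExtDiffs G = 0) := by
    unfold budget; constructor
    · intro h; omega
    · intro h; omega
  constructor
  · rcases hcases with h | h <;> rw [h] at hb <;> push_cast at hb
    · right; linarith
    · left; linarith
  · rw [← hiff]
    constructor
    · intro hm1
      rw [hm1] at hb
      have : (budget G : ℚ) = 4 := by linarith
      exact_mod_cast this
    · intro h4
      rw [h4] at hb
      push_cast at hb
      linarith

/-- **(3.25)** p. 439 [PDF 29]: the vector self-energy graphs of lowest order *"(D = −d + 2)"* — two vertices (1.8) with n + n′ = 1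
joined by both φ′-lines (two placements of the two differentiations: the first two pictures), or ONE vertex with two vector legs
((1.8) or (1.10) with n + n′ = 2) whose two φ′-legs are joined (the φ′-tadpoles, last two pictures; Ã-legs in place of
A′-legs give the same degrees) — are ALL the graphs of the model with two external vector legs, no external φ′-leg and D(G) = −1
(d = 3, n̄ ≥ 2), at the level of vertices and incidences: PROVED.  (The model does not impose connectedness: with two vertices
the two φ′-lines may also close into two tadpoles.) [cite: Balaban1983Higgs3, (3.25) p.439] -/
theorem lowestOrder_vectorSE (hn : 2 ≤ nbar) (hD : G.deg 3 = -1) (hs : numExtScalarLegs G = 0)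
    (hv : numExtVectorLegs G + numTildeLegs G = 2) :
    (G.nV = 2 ∧ ∀ i, (∃ n n', G.kind i = .v18 n n' ∧ n + n' = 1) ∧ G.intScalar i = 2 ∧ G.intVector i = 0 ∧
        G.intDiffs i = 1) ∨
    (G.nV = 1 ∧ ∀ i, ((∃ n n', G.kind i = .v18 n n' ∧ n + n' = 2) ∨ (∃ n n', G.kind i = .v110 n n' ∧ n + n' = 2)) ∧
        G.intScalar i = 2 ∧ G.intVector i = 0 ∧ G.intDiffs i = (G.kind i).diffCount) := by
  have hD' : G.deg 3 ≤ 0 := by rw [hD]; norm_num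
  have hG := not_hasVertex1315_of_deg_nonpos G hD'
  obtain ⟨hiv, h16, h17, hX⟩ := ((deg_vectorSE G hD' hs hv).2).mp hD
  have hV := nV_le G hG
  have h1 := one_le_nV G
  have hsc := two_nV_add_eq G hG
  have heo := eOrder_eq G
  have hkinds : ∀ i, (∃ n n', 1 ≤ n + n' ∧ G.kind i = .v18 n n') ∨ (∃ n n', 2 ≤ n + n' ∧ G.kind i = .v110 n n') :=
    fun i => kind_cases_tilde_le_two hn (G.kind i) (G.adm i) (isOfForm1315_eq_false G hG i) (kind_ne_v16 G h16 i)
      (kind_ne_v17 G h17 i) ((extVectorLegs_le G i).trans (by omega))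
  have hdiff : ∀ i, G.intDiffs i = (G.kind i).diffCount := fun i => by
    have := (sum_eq_zero_iff.mp hX) i (mem_univ i)
    have := G.intDiffs_le i
    omega
  have hiv0 : ∀ i, G.intVector i = 0 := fun i => (sum_eq_zero_iff.mp hiv) i (mem_univ i)
  have hdv1 : ∀ i, 1 ≤ (G.kind i).dv := fun i => by
    rcases hkinds i with ⟨n, n', h, hk'⟩ | ⟨n, n', h, hk'⟩ <;> rw [hk'] <;> simp [VertexKind.dv] <;> omega
  have hsle : ∀ i, G.intScalar i ≤ 2 := fun i => by
    have := G.intScalar_le i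
    rcases hkinds i with ⟨n, n', h, hk'⟩ | ⟨n, n', h, hk'⟩ <;> rw [hk'] at this <;> simpa [VertexKind.scalarLegs] using this
  rcases Nat.lt_or_ge G.nV 2 with hlt | hge
  · right
    have hnV : G.nV = 1 := by omega
    refine ⟨hnV, fun i => ⟨?_, ?_, hiv0 i, hdiff i⟩⟩
    · have hdv : (G.kind i).dv = 2 := by have := sum_eq_of_nV_eq_one G hnV i fun j => (G.kind j).dv; rw [← eOrder] at this; omega
      rcases hkinds i with ⟨n, n', h, hk'⟩ | ⟨n, n', h, hk'⟩ <;> rw [hk'] at hdv ⊢ <;> simp [VertexKind.dv] at hdv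
      · exact Or.inl ⟨n, n', rfl, hdv⟩
      · exact Or.inr ⟨n, n', rfl, hdv⟩
    · have hS := sum_eq_of_nV_eq_one G hnV i G.intScalar
      omega
  · left
    have hnV : G.nV = 2 := by omega
    obtain ⟨i₀, i₁, hne, hall, hsum⟩ := two_vertices G hnV
    have hDV := hsum fun j => (G.kind j).dv
    rw [← eOrder] at hDV
    have hS := hsum G.intScalar
    refine ⟨hnV, fun i => ⟨?_, ?_, hiv0 i, ?_⟩⟩
    · have hdv : (G.kind i).dv = 1 := by
        have := hdv1 i₀; have := hdv1 i₁
        rcases hall i with rfl | rfl <;> omega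
      rcases hkinds i with ⟨n, n', h, hk'⟩ | ⟨n, n', h, hk'⟩ <;> rw [hk'] at hdv ⊢ <;> simp [VertexKind.dv] at hdv
      · exact ⟨n, n', rfl, hdv⟩
      · omega
    · have := hsle i₀; have := hsle i₁
      rcases hall i with rfl | rfl <;> omega
    · have hdv : (G.kind i).dv = 1 := by
        have := hdv1 i₀; have := hdv1 i₁
        rcases hall i with rfl | rfl <;> omega
      rw [hdiff i]
      rcases hkinds i with ⟨n, n', h, hk'⟩ | ⟨n, n', h, hk'⟩ <;> rw [hk'] at hdv ⊢ <;> simp [VertexKind.dv] at hdv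
      · rfl
      · omega

/-! ## p. 435: which external legs a divergent graph can have -/

/-- d = 3: no divergent graph of the model has FOUR external φ′-legs (the only graph with four external legs is (2.4), with two
φ′-legs and two vector legs, p. 429; here: four φ′-legs and D(G) ≤ 0 is impossible whatever the vector legs).
[cite: Balaban1983Higgs3, (2.4) p.429] -/
theorem deg_pos_of_numExtScalarLegs_eq_four (hs : numExtScalarLegs G = 4) : 0 < G.deg 3 := by
  by_contra hD
  push Not at hD
  have hG := not_hasVertex1315_of_deg_nonpos G hD
  have hb6 := budget_le_six G hD
  have hV := nV_le G hG
  have h1 := one_le_nV G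
  have hsc := two_nV_add_eq G hG
  have heo := eOrder_eq G
  have hvl := sum_vectorLegs_eq G
  obtain ⟨k, hk⟩ := even_numIntVectorLegs G
  obtain ⟨m, hm⟩ := even_sum_intScalar G
  unfold budget at hb6
  have h17 : numV17 G = 0 := by omega
  have hX : numExtDiffs G = 0 := by omega
  by_cases h16 : numV16 G = 1
  · -- a lone vertex (1.6) with all its legs external has no line
    have hnV : G.nV = 1 := by omega
    obtain ⟨⟨i₀, -⟩, -⟩ := G.exists_line
    have hint := two_le_int_of_subsingleton G (fun i j => Fin.ext (by omega)) i₀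
    have hS := sum_eq_of_nV_eq_one G hnV i₀ G.intScalar
    have hIV : numIntVectorLegs G = G.intVector i₀ := sum_eq_of_nV_eq_one G hnV i₀ G.intVector
    omega
  · have h16' : numV16 G = 0 := by omega
    have ht : numTildeLegs G = 0 := by omega
    have hv : numExtVectorLegs G = 0 := by omega
    have hiv : numIntVectorLegs G = 2 := by omega
    have hnV : G.nV = 2 := by omega
    have hS0 : ∑ i, G.intScalar i = 0 := by omega
    -- two vertices (1.8)_{1,0} with all φ′-legs external: both differentiations are external
    have hkinds : ∀ i, (∃ n, 1 ≤ n ∧ G.kind i = .v18 n 0) ∨ (∃ n, 2 ≤ n ∧ G.kind i = .v110 n 0) := fun i =>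
      kind_cases_noTilde (G.kind i) (G.adm i) (isOfForm1315_eq_false G hG i) (kind_ne_v16 G h16' i) (kind_ne_v17 G h17 i)
        (extVectorLegs_eq_zero G ht i)
    obtain ⟨i₀, i₁, hne, hall, hsum⟩ := two_vertices G hnV
    have hVL := hsum fun j => (G.kind j).vectorLegs
    have hv1 : ∀ i, 1 ≤ (G.kind i).vectorLegs := fun i => by
      rcases hkinds i with ⟨n, hn, hk'⟩ | ⟨n, hn, hk'⟩ <;> rw [hk'] <;> simp [VertexKind.vectorLegs] <;> omega
    have hk18 : ∀ i, G.kind i = .v18 1 0 := by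
      intro i
      have hle : (G.kind i).vectorLegs ≤ 1 := by
        have h0 := hv1 i₀; have h1 := hv1 i₁
        rcases hall i with rfl | rfl <;> omega
      rcases hkinds i with ⟨n, hn, hk'⟩ | ⟨n, hn, hk'⟩ <;> rw [hk'] at hle ⊢ <;>
        simp [VertexKind.vectorLegs] at hle ⊢ <;> omega
    have hXsum := hsum fun j => (G.kind j).diffCount - G.intDiffs j
    rw [← numExtDiffs_eq, hX, hk18 i₀, hk18 i₁, show (VertexKind.v18 1 0).diffCount = 1 from rfl] at hXsum
    have hd0 := B3Cor23ConcreteTwoDim.intDiffs_le_intScalar G i₀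
    have hs0 := le_sum_of_mem G G.intScalar i₀
    omega

/-- **p. 435** [PDF 25] — which external legs a divergent graph can have.  d = 3, PROVED for every graph of the model with
D(G) ≤ 0: either no external φ′-leg and at most three external vector legs (A′ and Ã together), or exactly two external φ′-legs
and at most two external vector legs (odd numbers of φ′-legs: p. 431, `B3ScalarLegParity`; four φ′-legs:
`deg_pos_of_numExtScalarLegs_eq_four`; the total is bounded by the budget). [cite: Balaban1983Higgs3, p.435] -/
theorem extLegs_of_deg_nonpos (hD : G.deg 3 ≤ 0) :
    (numExtScalarLegs G = 0 ∧ numExtVectorLegs G + numTildeLegs G ≤ 3) ∨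
    (numExtScalarLegs G = 2 ∧ numExtVectorLegs G + numTildeLegs G ≤ 2) := by
  have hG := not_hasVertex1315_of_deg_nonpos G hD
  have hb6 := budget_le_six G hD
  have hV := nV_le G hG
  have h1 := one_le_nV G
  have heo := eOrder_eq G
  obtain ⟨m, hm⟩ := even_numExtScalarLegs_of_deg_nonpos G hD
  have h4 : numExtScalarLegs G ≠ 4 := fun h => by linarith [deg_pos_of_numExtScalarLegs_eq_four G h]
  unfold budget at hb6
  omega

/-- **p. 435** [PDF 25], verbatim: *"There are the following remaining possibilities for nonvacuum graphs: G₀ has two external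
scalar field legs, G₀ has two external vector field legs, G₀ has two external scalar field legs and one vector field leg."* —
PROVED on the model, d = 3: a divergent graph (D(G) ≤ 0) which is not a vacuum graph, not a graph with four external legs
(these are the graph (2.4), p. 429, `B3Graph24Unique.graph24_unique`) and not a graph with an odd number of external vector legs
and no other external legs (these vanish, p. 434, `B3OddVectorLoops`) has exactly the external legs of one of the three printed
possibilities (vector legs = A′-legs and Ã-legs together). [cite: Balaban1983Higgs3, p.435] -/
theorem remaining_possibilities (hD : G.deg 3 ≤ 0)
    (hnonvac : 1 ≤ numExtScalarLegs G + numExtVectorLegs G + numTildeLegs G)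
    (hnot4 : G.numExtLegs + numTildeLegs G ≠ 4)
    (hnotodd : numExtScalarLegs G = 0 → ¬ Odd (numExtVectorLegs G + numTildeLegs G)) :
    (numExtScalarLegs G = 2 ∧ numExtVectorLegs G + numTildeLegs G = 0) ∨
    (numExtScalarLegs G = 0 ∧ numExtVectorLegs G + numTildeLegs G = 2) ∨
    (numExtScalarLegs G = 2 ∧ numExtVectorLegs G + numTildeLegs G = 1) := by
  have hcl := extLegs_of_deg_nonpos G hD
  rw [numExtLegs_eq_add] at hnot4
  rcases hcl with ⟨hs, hv⟩ | ⟨hs, hv⟩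
  · have hno := hnotodd hs
    rcases Nat.even_or_odd (numExtVectorLegs G + numTildeLegs G) with ⟨k, hk⟩ | hodd
    · omega
    · exact absurd hodd hno
  · omega

end Literature.MathematicalPhysics.QuantumFieldTheory.Balaban1983to89.B3Sect3DivergentClasses
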